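/-
Copyright (c) 2026. All rights reserved.
Released under Apache 2.0 license as described in the file LICENSE.
-/
import Literature.Probability.FitznerVanDerHofstad2017.NobleBoundsNDispatchStarL
import Literature.Probability.FitznerVanDerHofstad2017.NobleBoundsNMidStar
import Literature.Probability.FitznerVanDerHofstad2017.NobleBoundsNMidStarZero
import Literature.Probability.FitznerVanDerHofstad2017.NobleBoundsNMidS
import Literature.Probability.FitznerVanDerHofstad2017.NobleBoundsNMidSOne
import Literature.Probability.FitznerVanDerHofstad2017.NobleBoundsNMidSZero
import Literature.Probability.FitznerVanDerHofstad2017.NobleBoundsNEndC1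
import HarnessLib

/-!
# Fitzner–van der Hofstad (2017), general `N`: the `★★` cells — a middle junction with BOTH levels closed

[FvdH17] R. Fitzner, R. van der Hofstad, *Mean-field behavior for nearest-neighbor percolation in `d > 10`*,
Electron. J. Probab. **22** (2017) no. 43, arXiv:1506.07977v2: §6.1 (6.4) and "Case a ≥ 2" × "Case b = 0 / 1 /
≥ 2" (pp. 58–59), §5.1 (5.4) and "Elements of the bounds" (pp. 48–49), (4.57)–(4.65) (pp. 41–43), App. B
(pp. 74–76).

A middle junction `k = i₀ + 1 ≤ M` whose lower level `k` AND upper level `k + 1` are both closed (`a_k = a_{k+1} = ★`: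
two consecutive special levels of the NoBLE decomposition).  The lower level is pinned (`z_k = w_k`,
`NobleBoundsNLowStar.JFacts.pin_closedL`) and owns no active slot (`jClosedL_not_act_lo`), so its cross letter
`A^{κ,2,c,*}(u_k,w_k,t_k,z_k)` is read as over a class-`2` level with the trivially witnessed line `{z_k ↔ w_k}`
(resp. `{t_k ↔ w_k}` at inner class `0`), exactly as in `NobleBoundsNLowStar`; the upper level is closed
(`w_{k+1} = u_k`, slots `0–3`, `NobleBoundsNClosedU`), so its letter is `A^{c,0}(t_k,z_k,u_{k+1},u_{k+1})`,
exactly as in `NobleBoundsNMidStar` / `NobleBoundsNMidStarZero`.  The kind bit is `false` (admissibility).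

* §A the four cells ON the pin `z_k = w_k`: `nonempty_jPkg_starStar_two / _one` (inner class `2` / `1`),
  `nonempty_jPkg_starStar_zero` (inner class `0` off the upper pin `t_k ≠ u_{k+1}`), `nonempty_jPkg_starStar_pin`
  (inner class `0` on it: the second term of (5.4), target `A'^{κ,2,0}(u_k,w_k,u_{k+1},t_k)`);
* §B the `★★` DISPATCH `nonempty_jPkg_mid_starStar`: on the sections `z_k = w_k`, `w_{k+1} = u_k` a package with
  target `tgtStarLU (Letters.perc d p) κ (u_k,w_k,t_k,z_k,w_{k+1},u_{k+1}) (τ i)` (`NobleBoundsNDispatchStarL`) — NO hypothesis slot: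
  this is the `hMLU` provider of `NobleBoundsNDispatchAll.nonempty_jPkg_all` (off the sections the piece is empty,
  `nonempty_jPkg_starStar_of_ne`).

Conventions: `d`-generic; nothing is cited as a fact; additive (no existing declaration is changed).
-/

noncomputable section

open scoped ENNReal

namespace Literature.Probability.FitznerVanDerHofstad2017

open Literature.Barriers.CriticalPhenomena Literature.Probability.Percolation
open Literature.Probability.LatticeModels Literature.Combinatorics.SimpleGraph _root_.SimpleGraph
open _root_.MeasureTheory
open Literature.Probability.FitznerVanDerHofstad2017.NobleBlocks
open Literature.Probability.FitznerVanDerHofstad2017.NobleBlocks.LenIdx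

variable {d : ℕ}

/-! ### A. The `★★` cells on the pin `z_k = w_k` -/

section Cells

variable (p : unitInterval) (M : ℕ) (x : Site d) (b : Fin (M + 2) → Site d × Site d) (w t z : Fin (M + 2) → Site d)
  (a : Fin (M + 2) → Fin 3 ⊕ Unit) (c : Fin 3 ⊕ Unit) (τ : Fin (M + 1) → Bool × Fin 3)

/-- **Cell `(★, 2, ★)`** of a middle junction `k = i₀ + 1 ≤ M` with both levels closed, on the pin `z_k = w_k`: a
package with target `A^{κ,2,2,*}(u_k,w_k,t_k,z_k) · A^{2,0}(t_k,z_k,u_{k+1},u_{k+1})` — the `c = 2` summand of the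
pinned-and-closed section of the first term of (5.4).  Entry letter: the bond, `{v ↔ t}`, `{t ←2→ z}` (inner class
`2`) and the trivially witnessed `{z ↔ w}`; exit letter `{t ←1→ u′}`, `{u′ ↔ z}` (`t ≠ u′` by the closed canonical
clause with `t ≠ z`).
[cite: FitznerVanDerHofstad2017, §6.1 (6.4), "Case a ≥ 2", "Case b ≥ 2" (arXiv:1506.07977v2 pp. 58–59); §5.1 (5.4) (p. 48) and "Elements of the bounds" (p. 49); (4.58), (4.62), (4.64) (pp. 41–42); App. B (pp. 74–76)] -/
theorem nonempty_jPkg_starStar_two (i i₀ : Fin (M + 1)) (hk : i₀.succ = i.castSucc) (κ : Fin d × Bool)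
    (hb : (b i.castSucc).2 = (b i.castSucc).1 + stepVec κ) (hc2 : (τ i).2 = 2) {u₀ u₁ : Unit}
    (ha : a i.castSucc = Sum.inr u₀) (ha' : a i.succ = Sum.inr u₁) (hzw : z i.castSucc = w i.castSucc) :
    Nonempty (JPkg p (jctx M x b w t z a τ i.castSucc) (JFacts M x b w t z a c τ)
      (blockAiotaSt (Letters.perc d p) κ 2 2 (b i.castSucc).1 (w i.castSucc) (t i.castSucc) (z i.castSucc) *
        blockA (Letters.perc d p) 2 0 (t i.castSucc) (z i.castSucc) (b i.succ).1 (b i.succ).1)) := by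
  -- degenerate parameters: the piece is empty
  by_cases hP : t i.castSucc ≠ z i.castSucc ∧ t i.castSucc ≠ (b i.succ).1
  swap
  · refine ⟨JPkg.vacuous p _ _ (fun ω K₀ hF => hP ?_) _⟩
    have htz := hF.t_ne_z_of_innerClass_ne_zero i (by rw [hc2]; decide)
    exact ⟨htz, (hF.ne_pin_closedU i ha' htz).2⟩
  obtain ⟨htz, hty⟩ := hP
  have huv : (b i.castSucc).1 ≠ (b i.castSucc).2 := by
    rw [hb]; exact (zdGraph_adj_iff_stepVec _ _ |>.2 ⟨κ, rfl⟩).ne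
  refine nonempty_jPkg_of_joint p i.castSucc glMidS1 true
    (midEv (event (eq 1) (b i.castSucc).1 (b i.castSucc).2) (event (ge 0) (b i.castSucc).2 (t i.castSucc))
      (event (ge 2) (t i.castSucc) (z i.castSucc)) (event (ge 1) (t i.castSucc) (b i.succ).1)
      (event (ge 0) (b i.succ).1 (z i.castSucc)) Set.univ Set.univ)
    (isFinitary_midEv _ _ _ _ _ _ _ (isFinitary_event _ _ _) (isFinitary_event _ _ _) (isFinitary_event _ _ _)
      (isFinitary_event _ _ _) (isFinitary_event _ _ _) isFinitary_univ isFinitary_univ)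
    (fun _ => by rw [midEv_xb]; exact singleton_mem_event_eq_one huv)
    (fun j j' _ _ hg => glMidS1_entry_closedU M x b w t z a τ i ha' j j' hg)
    (fun ω K₀ hF => ⟨fun j hj => ?_, fun j hj => ?_⟩) ?_
  · -- a closed lower level owns no active slot
    exact absurd hj (jClosedL_not_act_lo M x b w t z a τ i i₀ hk ha true false j)
  · -- the witnesses of level `k + 1` (slots `0`–`3`) lie in the upgraded events
    have hj4 : (j : ℕ) < 4 := (jClosedU_act_up_iff M x b w t z a τ i ha' true false j).1 hj
    have hj5 : j ≠ 5 := by intro h; rw [h] at hj4; exact absurd hj4 (by decide)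
    obtain ⟨h0, h1, h2, h3⟩ := hF.conn_closedU i ha'
    refine mem_midEv_up _ _ _ _ _ _ _ ?_ ?_ ?_ ?_ (Set.mem_univ _) j hj5
    · rw [event_ge]; exact mem_openConnGe_zero_of_mem h0
    · rw [event_ge]
      exact mem_openConnGe_two_of_notMem h1 htz fun hm =>
        (hF.innerClass_two i hc2).2 (hF.witness_subset _ 1 hm)
    · rw [event_ge]; exact mem_openConnGe_one_of_ne h2 hty
    · rw [event_comm, event_ge]; exact mem_openConnGe_zero_of_mem h3
  · -- the two letters
    refine (prod_junF_le₂ p M x b w t z a τ i.castSucc glMidS1 true false _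
      (show JIdx.xb ≠ JIdx.up 2 by decide)).trans (mul_le_mul' ?_ ?_)
    · -- `A^{κ,2,2,*}`: bond, `v → t`, `t ⇔ z` (+ the trivially witnessed `z ↔ w`)
      refine (junF_le_of_lines p M x b w t z a τ i.castSucc glMidS1 true false _ JIdx.xb
        ![JIdx.xb, .up 0, .up 1] (by decide) (fun m => ?_) ![0, 1, 1] (fun m => by fin_cases m <;> rfl)
        ![event (eq 1) (b i.castSucc).1 (b i.castSucc).2, event (ge 0) (b i.castSucc).2 (t i.castSucc),
          event (ge 2) (t i.castSucc) (z i.castSucc)]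
        (by funext m; fin_cases m <;> rfl)).trans ?_
      · fin_cases m
        · exact ⟨rfl, rfl⟩
        · exact ⟨(jClosedU_act_up_iff M x b w t z a τ i ha' true false 0).2 (by decide), rfl⟩
        · exact ⟨(jClosedU_act_up_iff M x b w t z a τ i ha' true false 1).2 (by decide), rfl⟩
      · refine (measure_mono (genDisjOcc_triple_subset_quad _ _ _ (event (ge 0) (z i.castSucc) (w i.castSucc))
          (by rw [hzw]; exact empty_mem_event_ge_zero_self (w i.castSucc)) 0 1 1 0)).trans ?_
        exact piPerc_midS_two_two_le_blockAiotaSt p hb ![0, 1, 1, 0]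
    · -- `A^{2,0}`: `t → u′`, `u′ → z` on level `k + 1`
      refine (junF_le_of_lines p M x b w t z a τ i.castSucc glMidS1 true false _ (JIdx.up 2)
        ![JIdx.up 2, .up 3] (by decide) (fun m => ?_) ![1, 1] (fun m => by fin_cases m <;> rfl)
        ![event (ge 1) (t i.castSucc) (b i.succ).1, event (ge 0) (b i.succ).1 (z i.castSucc)]
        (by funext m; fin_cases m <;> rfl)).trans ?_
      · fin_cases m
        · exact ⟨(jClosedU_act_up_iff M x b w t z a τ i ha' true false 2).2 (by decide), rfl⟩
        · exact ⟨(jClosedU_act_up_iff M x b w t z a τ i ha' true false 3).2 (by decide), rfl⟩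
      · exact piPerc_midS_two_zero_le_blockA p _

/-- **Cell `(★, 1, ★)`** of a middle junction with both levels closed, on the pin `z_k = w_k`: a package with
target `A^{κ,2,1,*}(u_k,w_k,t_k,z_k) · A^{1,0}(t_k,z_k,u_{k+1},u_{k+1})` — the `c = 1` summand.  Inner class `1`
makes the sausage line the open bond `{t ←1̲→ z}` itself (`JFacts.tz_witness_closedU`) and `z ~ t`; the closed
canonical clause gives `t, z ≠ u_{k+1}`, so `{t ←1→ u′}`, `{u′ ←1→ z}`.
[cite: FitznerVanDerHofstad2017, §6.1 (6.4), "Case a ≥ 2", "Case b = 1" (arXiv:1506.07977v2 pp. 58–59); §5.1 (5.4) (p. 48) and "Elements of the bounds" (p. 49); (4.58), (4.62), (4.64) (pp. 41–42); App. B (pp. 74–76)] -/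
theorem nonempty_jPkg_starStar_one (i i₀ : Fin (M + 1)) (hk : i₀.succ = i.castSucc) (κ : Fin d × Bool)
    (hb : (b i.castSucc).2 = (b i.castSucc).1 + stepVec κ) (hc1 : (τ i).2 = 1) {u₀ u₁ : Unit}
    (ha : a i.castSucc = Sum.inr u₀) (ha' : a i.succ = Sum.inr u₁) (hzw : z i.castSucc = w i.castSucc) :
    Nonempty (JPkg p (jctx M x b w t z a τ i.castSucc) (JFacts M x b w t z a c τ)
      (blockAiotaSt (Letters.perc d p) κ 2 1 (b i.castSucc).1 (w i.castSucc) (t i.castSucc) (z i.castSucc) *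
        blockA (Letters.perc d p) 1 0 (t i.castSucc) (z i.castSucc) (b i.succ).1 (b i.succ).1)) := by
  -- degenerate parameters: the piece is empty
  by_cases hP : (zdGraph d).Adj (t i.castSucc) (z i.castSucc) ∧
      t i.castSucc ≠ (b i.succ).1 ∧ z i.castSucc ≠ (b i.succ).1
  swap
  · refine ⟨JPkg.vacuous p _ _ (fun ω K₀ hF => hP ?_) _⟩
    have hadj := (hF.innerClass_one i hc1).2.2
    have hne := hF.ne_pin_closedU i ha' hadj.ne
    exact ⟨hadj, hne.2, hne.1⟩
  obtain ⟨hadj, hty, hzy⟩ := hP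
  have htz : t i.castSucc ≠ z i.castSucc := hadj.ne
  obtain ⟨κ', hκ'⟩ := (zdGraph_adj_iff_stepVec _ _).1 hadj
  have huv : (b i.castSucc).1 ≠ (b i.castSucc).2 := by
    rw [hb]; exact (zdGraph_adj_iff_stepVec _ _ |>.2 ⟨κ, rfl⟩).ne
  refine nonempty_jPkg_of_joint p i.castSucc glMidS1 true
    (midEv (event (eq 1) (b i.castSucc).1 (b i.castSucc).2) (event (ge 0) (b i.castSucc).2 (t i.castSucc))
      (event (eq 1) (t i.castSucc) (z i.castSucc)) (event (ge 1) (t i.castSucc) (b i.succ).1)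
      (event (ge 1) (b i.succ).1 (z i.castSucc)) Set.univ Set.univ)
    (isFinitary_midEv _ _ _ _ _ _ _ (isFinitary_event _ _ _) (isFinitary_event _ _ _) (isFinitary_event _ _ _)
      (isFinitary_event _ _ _) (isFinitary_event _ _ _) isFinitary_univ isFinitary_univ)
    (fun _ => by rw [midEv_xb]; exact singleton_mem_event_eq_one huv)
    (fun j j' _ _ hg => glMidS1_entry_closedU M x b w t z a τ i ha' j j' hg)
    (fun ω K₀ hF => ⟨fun j hj => ?_, fun j hj => ?_⟩) ?_
  · exact absurd hj (jClosedL_not_act_lo M x b w t z a τ i i₀ hk ha true false j)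
  · -- the witnesses of level `k + 1` (slots `0`–`3`): the sausage witness is the open bond itself
    have hj4 : (j : ℕ) < 4 := (jClosedU_act_up_iff M x b w t z a τ i ha' true false j).1 hj
    have hj5 : j ≠ 5 := by intro h; rw [h] at hj4; exact absurd hj4 (by decide)
    obtain ⟨h0, -, h2, h3⟩ := hF.conn_closedU i ha'
    have hK := hF.tz_witness_closedU i ha' htz (hF.innerClass_one i hc1).2.1
    refine mem_midEv_up _ _ _ _ _ _ _ ?_ ?_ ?_ ?_ (Set.mem_univ _) j hj5
    · rw [event_ge]; exact mem_openConnGe_zero_of_mem h0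
    · rw [hK]; exact singleton_mem_event_eq_one htz
    · rw [event_ge]; exact mem_openConnGe_one_of_ne h2 hty
    · rw [event_comm, event_ge]; exact mem_openConnGe_one_of_ne h3 hzy
  · -- the two letters
    refine (prod_junF_le₂ p M x b w t z a τ i.castSucc glMidS1 true false _
      (show JIdx.xb ≠ JIdx.up 2 by decide)).trans (mul_le_mul' ?_ ?_)
    · -- `A^{κ,2,1,*}`: bond, `v → t`, the open sausage bond (+ the trivially witnessed `z ↔ w`)
      refine (junF_le_of_lines p M x b w t z a τ i.castSucc glMidS1 true false _ JIdx.xb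
        ![JIdx.xb, .up 0, .up 1] (by decide) (fun m => ?_) ![0, 1, 1] (fun m => by fin_cases m <;> rfl)
        ![event (eq 1) (b i.castSucc).1 (b i.castSucc).2, event (ge 0) (b i.castSucc).2 (t i.castSucc),
          event (eq 1) (t i.castSucc) (z i.castSucc)]
        (by funext m; fin_cases m <;> rfl)).trans ?_
      · fin_cases m
        · exact ⟨rfl, rfl⟩
        · exact ⟨(jClosedU_act_up_iff M x b w t z a τ i ha' true false 0).2 (by decide), rfl⟩
        · exact ⟨(jClosedU_act_up_iff M x b w t z a τ i ha' true false 1).2 (by decide), rfl⟩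
      · refine (measure_mono (genDisjOcc_triple_subset_quad _ _ _ (event (ge 0) (z i.castSucc) (w i.castSucc))
          (by rw [hzw]; exact empty_mem_event_ge_zero_self (w i.castSucc)) 0 1 1 0)).trans ?_
        exact piPerc_midS_two_one_le_blockAiotaSt p hb ![0, 1, 1, 0]
    · -- `A^{1,0}`: `t → u′`, `u′ → z` on level `k + 1`, `z ~ t`
      refine (junF_le_of_lines p M x b w t z a τ i.castSucc glMidS1 true false _ (JIdx.up 2)
        ![JIdx.up 2, .up 3] (by decide) (fun m => ?_) ![1, 1] (fun m => by fin_cases m <;> rfl)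
        ![event (ge 1) (t i.castSucc) (b i.succ).1, event (ge 1) (b i.succ).1 (z i.castSucc)]
        (by funext m; fin_cases m <;> rfl)).trans ?_
      · fin_cases m
        · exact ⟨(jClosedU_act_up_iff M x b w t z a τ i ha' true false 2).2 (by decide), rfl⟩
        · exact ⟨(jClosedU_act_up_iff M x b w t z a τ i ha' true false 3).2 (by decide), rfl⟩
      · exact piPerc_midS_one_zero_le_blockA p hκ' _

/-- **Cell `(★, 0, ★)` off the upper pin** (`t_k ≠ u_{k+1}`) of a middle junction with both levels closed, on the
pin `z_k = w_k`: a package with target `A^{κ,2,0,*}(u_k,w_k,t_k,z_k) · A^{0,0}(t_k,z_k,u_{k+1},u_{k+1})` — the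
`c = 0` summand (`t_k = z_k`).  Entry letter: the bond and `{v ←1→ t}` (`v ≠ z = t`, (4.64) on a closed level,
`JFacts.v_ne_z_of_closedL`) with the trivially witnessed `{t ↔ w}`; exit letter the double connection `{t ⇔ u′}`.
[cite: FitznerVanDerHofstad2017, §6.1 (6.4), "Case a ≥ 2", "Case b = 0" (arXiv:1506.07977v2 pp. 58–59); §5.1 (5.4) (p. 48) and "Elements of the bounds" (p. 49); (4.58), (4.62), (4.64) (pp. 41–42); App. B (pp. 74–76)] -/
theorem nonempty_jPkg_starStar_zero (i i₀ : Fin (M + 1)) (hk : i₀.succ = i.castSucc) (κ : Fin d × Bool)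
    (hb : (b i.castSucc).2 = (b i.castSucc).1 + stepVec κ) (hc0 : (τ i).2 = 0) {u₀ u₁ : Unit}
    (ha : a i.castSucc = Sum.inr u₀) (ha' : a i.succ = Sum.inr u₁) (hzw : z i.castSucc = w i.castSucc)
    (hty : t i.castSucc ≠ (b i.succ).1) :
    Nonempty (JPkg p (jctx M x b w t z a τ i.castSucc) (JFacts M x b w t z a c τ)
      (blockAiotaSt (Letters.perc d p) κ 2 0 (b i.castSucc).1 (w i.castSucc) (t i.castSucc) (z i.castSucc) *
        blockA (Letters.perc d p) 0 0 (t i.castSucc) (z i.castSucc) (b i.succ).1 (b i.succ).1)) := by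
  -- degenerate parameters: the piece is empty
  by_cases hP : z i.castSucc = t i.castSucc ∧ (b i.castSucc).2 ≠ z i.castSucc
  swap
  · refine ⟨JPkg.vacuous p _ _ (fun ω K₀ hF => hP ?_) _⟩
    exact ⟨(hF.t_eq_z_of_innerClass_zero i hc0).symm, hF.v_ne_z_of_closedL i i₀ hk ha⟩
  obtain ⟨hzt, hvz⟩ := hP
  have huv : (b i.castSucc).1 ≠ (b i.castSucc).2 := by
    rw [hb]; exact (zdGraph_adj_iff_stepVec _ _ |>.2 ⟨κ, rfl⟩).ne
  have hvt : (b i.castSucc).2 ≠ t i.castSucc := by rw [← hzt]; exact hvz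
  have htw : t i.castSucc = w i.castSucc := hzt.symm.trans hzw
  rw [hzt]
  refine nonempty_jPkg_of_joint p i.castSucc glMidS0 true
    (midEv (event (eq 1) (b i.castSucc).1 (b i.castSucc).2) (event (ge 1) (b i.castSucc).2 (t i.castSucc))
      Set.univ (event (ge 0) (t i.castSucc) (b i.succ).1) (event (ge 0) (t i.castSucc) (b i.succ).1) Set.univ
      Set.univ)
    (isFinitary_midEv _ _ _ _ _ _ _ (isFinitary_event _ _ _) (isFinitary_event _ _ _) isFinitary_univ
      (isFinitary_event _ _ _) (isFinitary_event _ _ _) isFinitary_univ isFinitary_univ)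
    (fun _ => by rw [midEv_xb]; exact singleton_mem_event_eq_one huv)
    (fun j j' _ _ hg => glMidS0_entry_closedU M x b w t z a τ i ha' j j' hg)
    (fun ω K₀ hF => ⟨fun j hj => ?_, fun j hj => ?_⟩) ?_
  · exact absurd hj (jClosedL_not_act_lo M x b w t z a τ i i₀ hk ha true false j)
  · -- the witnesses of level `k + 1` (slots `0`–`3`) lie in the upgraded events
    have hj4 : (j : ℕ) < 4 := (jClosedU_act_up_iff M x b w t z a τ i ha' true false j).1 hj
    have hj5 : j ≠ 5 := by intro h; rw [h] at hj4; exact absurd hj4 (by decide)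
    obtain ⟨h0, -, h2, h3⟩ := hF.conn_closedU i ha'
    rw [hzt] at h3
    refine mem_midEv_up _ _ _ _ _ _ _ ?_ (Set.mem_univ _) ?_ ?_ (Set.mem_univ _) j hj5
    · rw [event_ge]; exact mem_openConnGe_one_of_ne h0 hvt
    · rw [event_ge]; exact mem_openConnGe_zero_of_mem h2
    · rw [event_ge]; exact mem_openConnGe_zero_of_mem h3
  · -- the two letters
    refine (prod_junF_le₂ p M x b w t z a τ i.castSucc glMidS0 true false _
      (show JIdx.xb ≠ JIdx.up 2 by decide)).trans (mul_le_mul' ?_ ?_)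
    · -- `A^{κ,2,0,*}`: bond, `v → t` (+ the trivially witnessed `t ↔ w`)
      refine (junF_le_of_lines p M x b w t z a τ i.castSucc glMidS0 true false _ JIdx.xb
        ![JIdx.xb, .up 0] (by decide) (fun m => ?_) ![0, 1] (fun m => by fin_cases m <;> rfl)
        ![event (eq 1) (b i.castSucc).1 (b i.castSucc).2, event (ge 1) (b i.castSucc).2 (t i.castSucc)]
        (by funext m; fin_cases m <;> rfl)).trans ?_
      · fin_cases m
        · exact ⟨rfl, rfl⟩
        · exact ⟨(jClosedU_act_up_iff M x b w t z a τ i ha' true false 0).2 (by decide), rfl⟩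
      · refine (measure_mono (genDisjOcc_pair_subset_triple _ _ (event (ge 0) (t i.castSucc) (w i.castSucc))
          (by rw [htw]; exact empty_mem_event_ge_zero_self (w i.castSucc)) 0 1 0)).trans ?_
        exact piPerc_midS_two_zero_le_blockAiotaSt p hb ![0, 1, 0]
    · -- `A^{0,0}`: the double connection `t ⇔ u′` on level `k + 1`
      refine (junF_le_of_lines p M x b w t z a τ i.castSucc glMidS0 true false _ (JIdx.up 2)
        ![JIdx.up 2, .up 3] (by decide) (fun m => ?_) ![1, 1] (fun m => by fin_cases m <;> rfl)
        ![event (ge 0) (t i.castSucc) (b i.succ).1, event (ge 0) (t i.castSucc) (b i.succ).1]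
        (by funext m; fin_cases m <;> rfl)).trans ?_
      · fin_cases m
        · exact ⟨(jClosedU_act_up_iff M x b w t z a τ i ha' true false 2).2 (by decide), rfl⟩
        · exact ⟨(jClosedU_act_up_iff M x b w t z a τ i ha' true false 3).2 (by decide), rfl⟩
      · exact piPerc_midS_zero_zero_le_blockA p hty _ rfl

/-- **Cell `(★, 0, ★)` on the upper pin** (`t_k = u_{k+1}`) of a middle junction with both levels closed, on the
pin `z_k = w_k`: then `z_k = t_k = w_k = u_{k+1}` (the closed level `k + 1` is the bare backbone piece
`b̄_k → u_{k+1}`), and a package with target `A'^{κ,2,0}(u_k,w_k,u_{k+1},t_k)` — the second term of (5.4) at its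
internal vertex (`δ_{z,t} = 1`, `P^0(0,0) = 1`).  The single genuine letter is the bond and `{v ←1→ t}` with the
trivially witnessed `{t ↔ w}`; twin of `nonempty_jPkg_closedU_pin` over the closed-lower readings.
[cite: FitznerVanDerHofstad2017, §6.1 (6.4), "Case a ≥ 2", "Case b = 0" (arXiv:1506.07977v2 pp. 58–59); §5.1 (5.4) second term (p. 48); (4.58), (4.62), (4.64) (pp. 41–42); App. B (pp. 74–76)] -/
theorem nonempty_jPkg_starStar_pin (i i₀ : Fin (M + 1)) (hk : i₀.succ = i.castSucc) (κ : Fin d × Bool)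
    (hb : (b i.castSucc).2 = (b i.castSucc).1 + stepVec κ) (hc0 : (τ i).2 = 0) {u₀ u₁ : Unit}
    (ha : a i.castSucc = Sum.inr u₀) (ha' : a i.succ = Sum.inr u₁) (hzw : z i.castSucc = w i.castSucc)
    (hty : t i.castSucc = (b i.succ).1) :
    Nonempty (JPkg p (jctx M x b w t z a τ i.castSucc) (JFacts M x b w t z a c τ)
      (blockAiota' (Letters.perc d p) κ 2 0 (b i.castSucc).1 (w i.castSucc) (b i.succ).1 (t i.castSucc))) := by
  -- degenerate parameters: the piece is empty
  by_cases hP : z i.castSucc = t i.castSucc ∧ (b i.castSucc).2 ≠ z i.castSucc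
  swap
  · refine ⟨JPkg.vacuous p _ _ (fun ω K₀ hF => hP ?_) _⟩
    exact ⟨(hF.t_eq_z_of_innerClass_zero i hc0).symm, hF.v_ne_z_of_closedL i i₀ hk ha⟩
  obtain ⟨hzt, hvz⟩ := hP
  have huv : (b i.castSucc).1 ≠ (b i.castSucc).2 := by
    rw [hb]; exact (zdGraph_adj_iff_stepVec _ _ |>.2 ⟨κ, rfl⟩).ne
  have hvt : (b i.castSucc).2 ≠ t i.castSucc := by rw [← hzt]; exact hvz
  have htw : t i.castSucc = w i.castSucc := hzt.symm.trans hzw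
  rw [← hty, blockAiota'_of_ne (Letters.perc d p) κ (a := 2) (b := 0) fun h => absurd h.1 (by decide)]
  refine nonempty_jPkg_of_joint p i.castSucc glMidS1 true
    (midF1Ev (event (eq 1) (b i.castSucc).1 (b i.castSucc).2) (event (ge 1) (b i.castSucc).2 (t i.castSucc))
      Set.univ Set.univ)
    (isFinitary_midEv _ _ _ _ _ _ _ (isFinitary_event _ _ _) (isFinitary_event _ _ _) isFinitary_univ
      isFinitary_univ isFinitary_univ isFinitary_univ isFinitary_univ)
    (fun _ => by rw [midF1Ev, midEv_xb]; exact singleton_mem_event_eq_one huv)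
    (fun j j' _ _ hg => glMidS1_entry_closedU M x b w t z a τ i ha' j j' hg)
    (fun ω K₀ hF => ⟨fun j hj => ?_, fun j hj => ?_⟩) ?_
  · exact absurd hj (jClosedL_not_act_lo M x b w t z a τ i i₀ hk ha true false j)
  · -- the witnesses of level `k + 1` (slots `0`–`3`): only the entry line `v → t` is constrained
    have hj4 : (j : ℕ) < 4 := (jClosedU_act_up_iff M x b w t z a τ i ha' true false j).1 hj
    have hj5 : j ≠ 5 := by intro h; rw [h] at hj4; exact absurd hj4 (by decide)
    obtain ⟨h0, -⟩ := hF.conn_closedU i ha'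
    refine mem_midEv_up _ _ _ _ _ _ _ ?_ (Set.mem_univ _) (Set.mem_univ _) (Set.mem_univ _) (Set.mem_univ _) j hj5
    rw [event_ge]; exact mem_openConnGe_one_of_ne h0 hvt
  · -- one genuine letter: bond, `v → t` (+ the trivially witnessed `t ↔ w`)
    refine (prod_junF_le₂ p M x b w t z a τ i.castSucc glMidS1 true false _
      (show JIdx.xb ≠ JIdx.up 2 by decide)).trans ?_
    refine (mul_le_mul' ?_ (junF_le_one p M x b w t z a τ i.castSucc glMidS1 true false _ _)).trans
      (le_of_eq (mul_one _))
    refine (junF_le_of_lines p M x b w t z a τ i.castSucc glMidS1 true false _ JIdx.xb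
      ![JIdx.xb, .up 0] (by decide) (fun m => ?_) ![0, 1] (fun m => by fin_cases m <;> rfl)
      ![event (eq 1) (b i.castSucc).1 (b i.castSucc).2, event (ge 1) (b i.castSucc).2 (t i.castSucc)]
      (by funext m; fin_cases m <;> rfl)).trans ?_
    · fin_cases m
      · exact ⟨rfl, rfl⟩
      · exact ⟨(jClosedU_act_up_iff M x b w t z a τ i ha' true false 0).2 (by decide), rfl⟩
    · refine (measure_mono (genDisjOcc_pair_subset_triple _ _ (event (ge 0) (t i.castSucc) (w i.castSucc))
        (by rw [htw]; exact empty_mem_event_ge_zero_self (w i.castSucc)) 0 1 0)).trans ?_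
      exact piPerc_midF1_two_zero_le_blockAiota p hb ![0, 1, 0]

end Cells

/-! ### B. The `★★` dispatch on the sections -/

section Packages

variable (p : unitInterval) (M : ℕ) (x : Site d) (b : Fin (M + 2) → Site d × Site d) (w t z : Fin (M + 2) → Site d)
  (a : Fin (M + 2) → Fin 3 ⊕ Unit) (c : Fin 3 ⊕ Unit) (τ : Fin (M + 1) → Bool × Fin 3)


/-- **`pkg` at a `★★` MIDDLE junction `k = i₀ + 1 ≤ M` on its sections** (`a_k = a_{k+1} = ★`, `z_k = w_k`,
`w_{k+1} = u_k`): a package with target `tgtStarLU (Letters.perc d p) κ (u_k,w_k,t_k,z_k,w_{k+1},u_{k+1}) (τ i)` — the `hMLU`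
provider of `NobleBoundsNDispatchAll.nonempty_jPkg_all`, with no hypothesis slot.  A variant with kind bit `true`
is inadmissible below a closed level (the piece is empty); inner class `2 / 1` → `nonempty_jPkg_starStar_two /
_one`; inner class `0` off the upper pin → `…_starStar_zero`, on it → `…_starStar_pin` (`z_k = t_k` or the piece
is empty; there `δ_{z,t} = P^0(0,0) = 1`).
[cite: FitznerVanDerHofstad2017, §6.1 (6.4) and "Case a ≥ 2" × "Case b = 0 / 1 / ≥ 2" (arXiv:1506.07977v2 pp. 58–59); §5.1 (5.4) (p. 48) and "Elements of the bounds" (p. 49); (4.58), (4.62), (4.64) (pp. 41–42); App. B (pp. 74–76)] -/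
theorem nonempty_jPkg_mid_starStar (i i₀ : Fin (M + 1)) (hk : i₀.succ = i.castSucc) (κ : Fin d × Bool)
    (hb : (b i.castSucc).2 = (b i.castSucc).1 + stepVec κ) {u₀ u₁ : Unit} (ha : a i.castSucc = Sum.inr u₀)
    (ha' : a i.succ = Sum.inr u₁) (hzw : z i.castSucc = w i.castSucc) (hwu : w i.succ = (b i.castSucc).1) :
    Nonempty (JPkg p (jctx M x b w t z a τ i.castSucc) (JFacts M x b w t z a c τ)
      (tgtStarLU (Letters.perc d p) κ (b i.castSucc).1 (w i.castSucc) (t i.castSucc) (z i.castSucc) (w i.succ) (b i.succ).1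
        (τ i))) := by
  have h3 : ∀ e : Fin 3, e = 0 ∨ e = 1 ∨ e = 2 := by decide
  rw [tgtStarLU_of_eq (Letters.perc d p) κ _ _ _ _ _ _ hzw]
  rcases Bool.eq_false_or_eq_true (τ i).1 with hσ | hσ
  · -- kind bit `true` below a closed level: inadmissible, the piece is empty
    refine ⟨JPkg.vacuous p _ _ (fun ω K₀ hF => ?_) _⟩
    have h : (τ i).1 = false := hF.mem.1 i (by rw [ha']; rfl)
    rw [hσ] at h
    exact Bool.noConfusion h
  rcases h3 (τ i).2 with hc | hc | hc
  · have hv : τ i = (false, 0) := Prod.ext hσ hc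
    by_cases hty : t i.castSucc = (b i.succ).1
    · -- on the upper pin: `z_k = t_k` or the piece is empty
      by_cases hzt : z i.castSucc = t i.castSucc
      swap
      · exact nonempty_jPkg_of_innerClass_zero_ne p c _ i hc (Ne.symm hzt) _
      obtain ⟨P⟩ := nonempty_jPkg_starStar_pin p M x b w t z a c τ i i₀ hk κ hb hc ha ha' hzw hty
      refine ⟨P.mono (le_of_eq ?_)⟩
      rw [hv, tgtStarU_pin (Letters.perc d p) κ 2 _ _ _ _ _ _ hwu hty, hzt, kd_self, one_mul, ← hty, sub_self, blockPS_zero,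
        kd_self, one_mul]
      simp [Letters.pdbc]
    · rw [hv, tgtStarU_false (Letters.perc d p) κ 2 _ _ _ _ _ _ hwu 0 (fun h => hty h.2),
        blockAiotaSt'_of_ne (Letters.perc d p) κ (a := 2) (b := 0) fun h => absurd h.1 (by decide)]
      exact nonempty_jPkg_starStar_zero p M x b w t z a c τ i i₀ hk κ hb hc ha ha' hzw hty
  · have hv : τ i = (false, 1) := Prod.ext hσ hc
    rw [hv, tgtStarU_false (Letters.perc d p) κ 2 _ _ _ _ _ _ hwu 1 (fun h => absurd h.1 (by decide)),
      blockAiotaSt'_of_ne (Letters.perc d p) κ (a := 2) (b := 1) fun h => absurd h.1 (by decide)]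
    exact nonempty_jPkg_starStar_one p M x b w t z a c τ i i₀ hk κ hb hc ha ha' hzw
  · have hv : τ i = (false, 2) := Prod.ext hσ hc
    rw [hv, tgtStarU_false (Letters.perc d p) κ 2 _ _ _ _ _ _ hwu 2 (fun h => absurd h.1 (by decide)),
      blockAiotaSt'_of_ne (Letters.perc d p) κ (a := 2) (b := 2) fun h => absurd h.1 (by decide)]
    exact nonempty_jPkg_starStar_two p M x b w t z a c τ i i₀ hk κ hb hc ha ha' hzw

end Packages

end Literature.Probability.FitznerVanDerHofstad2017

end
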